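import Literature.AlgebraicGeometry.HilbertScheme.NakajimaOperators
import Mathlib.LinearAlgebra.Matrix.ToLin
import HarnessLib

/-!
# Lane (V), line v2p5 for `LefschetzGenerationHilb n` — definitions

Cell `hodge-kum4`, crux stmt-Ventures-20141 (`LefschetzGenerationHilb5 = LefschetzGenerationHilb 5`, lane (V)), prover seat
hodge-kum4-p5.  The V2 mechanism (planner memo `pub/hodge-kum4/plan/V2-MECHANISM.md` v1.1) proves `L1-Hilb(n)` for
EVERY `n` from (i) the super operator calculus of transfer operators, (ii) a finite certificate about the Lie
sub-superalgebra of `𝔤𝔩(Λ*ℚ⁴) ⊗ ℚ[t, t⁻¹]` generated by `t·m_x` (`1 ≤ |x| ≤ 3`) and `t⁻¹·Λ`, (iii) Vandermonde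
evaluation, (iv) cut-and-join / polarisation bookkeeping in the Fock space.  This file holds the DEFINITIONS shared
by the stub files of the registered skeleton (`ledger skeleton check`, stubs `stub_superLie`, `stub_lehnSuper`,
`stub_model`, `stub_cert`, `stub_eval`, `stub_span`):

* the integer model `Λ*ℤ⁴` on bitmasks `I : Fin 16` — `deg4`, `wsign`, `mulMat I` (left exterior multiplication by
  `e_I`), `lamMat` (the dual Lefschetz operator of `e₀e₁ + e₂e₃`), `sbrMat` (super-bracket), `IsHomogMat`;
* `LieCert : Prop` — the loop-superalgebra certificate (S2) in CONSUMABLE form (existence of a straight-line program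
  of super-brackets with index sets `E`, `O` and exact integer identities `[E,E] ⊇ E`, `[E,O] ⊇ O`,
  `1, E_{I,0} ∈ span(E ∪ O)`); it is an OBLIGATION (proved by the stub file `…L1HilbCert`, by `decide`), not a fact;
* the Hilbert-side words `twoPt` (single-weight two-point operator `τ_k(φ)|ₙ`), `polar` (rank-one polarisation
  `x ↦ b₀^∨(x)·b I`), `StableUnder`.

HONEST FRAMING: definitions only; nothing here asserts L1-Hilb(n) / L1 / HC_Kum4Type / HC.
-/

noncomputable section

open scoped TensorProduct
open Literature.AlgebraicGeometry Literature.AlgebraicGeometry.Hyperkaehler Literature.AlgebraicGeometry.HilbertScheme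
open Literature.AlgebraicGeometry.Motives (ComplexPoints SchemeOver IsSmoothProjective)

namespace Summit.Ventures.HodgeKum4.L1Hilb

/-! ### The integer model `Λ*ℤ⁴` on bitmasks `I : Fin 16` -/

/-- Number of set bits among the low four bits of `m` (the cohomological degree of `e_I`, `I = m`). -/
def deg4N (m : ℕ) : ℕ :=
  (m &&& 1) + ((m >>> 1) &&& 1) + ((m >>> 2) &&& 1) + ((m >>> 3) &&& 1)

/-- Degree `|I|` of the basis element `e_I` of `Λ*ℤ⁴`, `I ⊂ {0,1,2,3}` a bitmask. -/
def deg4 (I : Fin 16) : ℕ :=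
  deg4N I.val

/-- Number of pairs `(i ∈ I, j ∈ J)` with `j < i` (inversions of the concatenation `I · J`). -/
def inversions (I J : Fin 16) : ℕ :=
  ((List.range 4).map fun i ↦ if I.val.testBit i then deg4N (J.val &&& (2 ^ i - 1)) else 0).sum

/-- Sign of `e_I ∧ e_J = ± e_{I ∪ J}` (`0` if `I ∩ J ≠ ∅`). -/
def wsign (I J : Fin 16) : ℤ :=
  if I.val &&& J.val ≠ 0 then 0 else (-1) ^ inversions I J

/-- Union of bitmasks. -/
def bor (I J : Fin 16) : Fin 16 :=
  ⟨I.val ||| J.val, Nat.or_lt_two_pow (n := 4) I.isLt J.isLt⟩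

/-- Left exterior multiplication `m_{e_I}` on `Λ*ℤ⁴`: `e_P ↦ wsign I P · e_{I ∪ P}` (column `P`, row `Q`). -/
def mulMat (I : Fin 16) : Matrix (Fin 16) (Fin 16) ℤ :=
  fun Q P ↦ if Q = bor I P then wsign I P else 0

/-- The dual Lefschetz operator `Λ` of `L = m_{e₀e₁ + e₂e₃}` on `Λ*ℤ⁴` (all eight entries `1`). -/
def lamMat : Matrix (Fin 16) (Fin 16) ℤ :=
  fun Q P ↦ if (Q.val, P.val) ∈ [(0, 3), (0, 12), (4, 7), (8, 11), (1, 13), (2, 14), (3, 15), (12, 15)] then 1 else 0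

/-- Super-bracket of integer matrices with the parities of the degree shifts `da`, `db`:
`[A, B} = AB − (−1)^{|da||db|} BA`. -/
def sbrMat (A : Matrix (Fin 16) (Fin 16) ℤ) (da : ℤ) (B : Matrix (Fin 16) (Fin 16) ℤ) (db : ℤ) :
    Matrix (Fin 16) (Fin 16) ℤ :=
  A * B - ((-1 : ℤ) ^ (da.natAbs * db.natAbs)) • (B * A)

/-- `M` is homogeneous of degree `d` for the grading `deg4`: `M_{QP} ≠ 0 ⇒ |Q| = |P| + d`. -/
def IsHomogMat (M : Matrix (Fin 16) (Fin 16) ℤ) (d : ℤ) : Prop :=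
  ∀ Q P, M Q P ≠ 0 → (deg4 Q : ℤ) = deg4 P + d

/-! ### The words on the Hilbert side -/

variable {S : SchemeOver ℂ} {hS : IsSmoothProjective 2 S} {H : HilbertSchemesOfPoints S}

/-- The single-weight two-point operator `τ_k(φ)|ₙ = (Σᵢ 𝔮_k(φ εᵢ) 𝔮₋ₖ(eᵢ))|_{H*(S^[n])}`. -/
def twoPt (𝔑 : NakajimaOperators hS H)
    (C : totalCohomology ℂ (ComplexPoints S) ⊗[ℂ] totalCohomology ℂ (ComplexPoints S))
    (φ : Module.End ℂ (totalCohomology ℂ (ComplexPoints S))) (k n : ℕ) :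
    Module.End ℂ (totalCohomology ℂ (ComplexPoints (H.obj n))) :=
  restrictFock ℂ (fockFamily H) (transferTerm ℂ 𝔑.q C φ (k : ℤ)) n

/-- The polarisation `x ↦ b₀^∨(x) · b I` (rank one; in the model the matrix unit `E_{I,0}`). -/
def polar {ι : Type} (b : Module.Basis ι ℂ (totalCohomology ℂ (ComplexPoints S))) (i₀ i : ι) :
    Module.End ℂ (totalCohomology ℂ (ComplexPoints S)) :=
  (b.coord i₀).smulRight (b i)

/-- `W ⊆ H*(S^[n])` is stable under the block `X|ₙ` of an operator `X` on `ℍ` that preserves `ℍₙ`. -/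
def StableUnder (n : ℕ) (W : Submodule ℂ (totalCohomology ℂ (ComplexPoints (H.obj n))))
    (X : Module.End ℂ (fockSpace H)) : Prop :=
  (∀ y, X (Fock.ofSummand ℂ (fockFamily H) n y) ∈ LinearMap.range (Fock.ofSummand ℂ (fockFamily H) n)) ∧
    ∀ w ∈ W, restrictFock ℂ (fockFamily H) X n w ∈ W

/-! ### The certificate statement (S-D), as integer-matrix identities -/

/-- The loop-superalgebra certificate in consumable form: a straight-line program of super-brackets from the 15
generators `(mulMat I, t = 1, d = |I|)` (`1 ≤ |I| ≤ 3`) and `(lamMat, t = −1, d = −2)`, index sets `E` (t-degree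
`−2`) and `O` (`−3`), and exact integer identities: `[E,E] ⊇ E`, `[E,O] ⊇ O`, and `1`, `E_{I,0}` (`I ≠ 0`) in
`span(E ∪ O)`.  Stated abstractly (existence of the data); proved by exhibiting it (`decide`). -/
def LieCert : Prop :=
  ∃ (N : ℕ) (node : ℕ → Matrix (Fin 16) (Fin 16) ℤ) (tdeg deg : ℕ → ℤ) (isE isO : ℕ → Bool),
    -- program: every node is a generator or a super-bracket of two earlier nodes
    (∀ k < N, (∃ I : Fin 16, deg4 I ∈ ({1, 2, 3} : Set ℕ) ∧ node k = mulMat I ∧ tdeg k = 1 ∧ deg k = deg4 I) ∨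
      (node k = lamMat ∧ tdeg k = -1 ∧ deg k = -2) ∨
      (∃ i < k, ∃ j < k, node k = sbrMat (node i) (deg i) (node j) (deg j) ∧
        tdeg k = tdeg i + tdeg j ∧ deg k = deg i + deg j)) ∧
    (∀ k < N, IsHomogMat (node k) (deg k)) ∧
    (∀ k, isE k = true → k < N ∧ tdeg k = -2) ∧ (∀ k, isO k = true → k < N ∧ tdeg k = -3) ∧
    -- [E,E] ⊇ E and [E,O] ⊇ O, with cleared denominators
    (∀ m, isE m = true → ∃ (L : ℤ) (terms : List (ℕ × ℕ × ℤ)), L ≠ 0 ∧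
      (∀ t ∈ terms, isE t.1 = true ∧ isE t.2.1 = true) ∧
      L • node m = (terms.map fun t ↦ t.2.2 • sbrMat (node t.1) (deg t.1) (node t.2.1) (deg t.2.1)).sum) ∧
    (∀ m, isO m = true → ∃ (L : ℤ) (terms : List (ℕ × ℕ × ℤ)), L ≠ 0 ∧
      (∀ t ∈ terms, isE t.1 = true ∧ isO t.2.1 = true) ∧
      L • node m = (terms.map fun t ↦ t.2.2 • sbrMat (node t.1) (deg t.1) (node t.2.1) (deg t.2.1)).sum) ∧
    -- targets: the identity and the matrix units E_{I,0}, I ≠ 0, in span(E ∪ O)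
    (∃ (L : ℤ) (terms : List (ℕ × ℤ)), L ≠ 0 ∧ (∀ t ∈ terms, isE t.1 = true ∨ isO t.1 = true) ∧
      L • (1 : Matrix (Fin 16) (Fin 16) ℤ) = (terms.map fun t ↦ t.2 • node t.1).sum) ∧
    (∀ I : Fin 16, I ≠ 0 → ∃ (L : ℤ) (terms : List (ℕ × ℤ)), L ≠ 0 ∧ (∀ t ∈ terms, isE t.1 = true ∨ isO t.1 = true) ∧
      L • Matrix.single I (0 : Fin 16) (1 : ℤ) = (terms.map fun t ↦ t.2 • node t.1).sum)

end Summit.Ventures.HodgeKum4.L1Hilb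

end
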